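import Mathlib
import HarnessLib
import HarnessLib.Audit
import Summits.SmoothPoincare4.Statement
import Literature.Topology.FourManifolds.GluckTwist
import Literature.Topology.FourManifolds.CappellShaneson
import Literature.Topology.FourManifolds.SurgeryGluck
import Literature.Topology.FourManifolds.Knots

/-!
Route: GluckLasagna

CLOSED (closed) 2026-08-15T12:55:57Z by planner-SmoothPoincare4-route-SmoothPoincare4-GluckLasagna-0 — reason: route-repair guardrail: kill criterion 2 fired in print for the posited detector (RenWillis2024 Prop 6.17; Ren-Sullivan-Wedrich-Willis-Zhang 2025 Thm 7.1: gl2 lasagna modules over Q are Gluck-twist invariant); sole crux untypeable (no skein — note: route-repair guardrail (planner, 2026-08-15): CLOSED as exhausted — the route's own KILL CRITERION 2 ("S₀(Σ;∅) ≅ S₀(S⁴;∅) for the homotopy spheres in question ⇒ crux 2 dead ⇒ close unless another unforced invariant is named") FIRED IN PRINT for the posited object; no replacement object with evidence. The file is kept as the record of this route; refuted decls are indexed as negative knowledge (`ledger negatives`).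

# Route GluckLasagna (SmoothPoincare4, negative side; categorified invariants) —
planner-SmoothPoincare4-Survey-0, 2026-08-13

## Thesis X (assembly X → ¬SmoothPoincare4)
Words: some Gluck twist Σ_K of S⁴ along a 2-knot K is not diffeomorphic to S⁴
(¬GluckTwistConjecture, universe 0).
Lean (elaborates against overlay build 2026-08-13; opens `open scoped Manifold ContDiff`):
`∃ (K : Literature.Topology.FourManifolds.TwoKnot) (X : Type) (_ : TopologicalSpace X) (_ : T2Space
X) (_ : SecondCountableTopology X) (_ : ChartedSpace (EuclideanSpace ℝ (Fin 4)) X) (_ : IsManifold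
(𝓡 4) ∞ X), Literature.Topology.FourManifolds.IsGluckTwist (𝓡 4) X K ∧ IsEmpty (X ≃ₘ⟮𝓡 4, 𝓡 4⟯
Metric.sphere (0 : EuclideanSpace ℝ (Fin 5)) 1)`

## Assembly (rank 1)
X → ¬SmoothPoincare4: a Gluck twist is a closed smooth simply connected 4-manifold ≃ₕ S⁴ (Literature
GluckTwist.lean:
`simplyConnectedSpace_of_isGluckTwist`, `IsGluckTwist.compactSpace`,
`nonempty_homeomorph_sphere_of_isGluckTwist` [Gluck1962 §17,
Freedman1982]); a homeomorphism to S⁴ gives the homotopy equivalence SPC4 consumes. Purely formal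
once X holds.

## Why this line
Gluck twists are the oldest and largest natural family of homotopy 4-spheres [Gluck1962; Kirby1997,
4.24]; all members shown
standard so far (twist-spun [Gordon1976], ribbon-type families, [AkbulutKirby1985], …) were done by
handle tricks, never by an
invariant, because every classical/gauge-theoretic invariant of a homotopy 4-sphere is forced to
equal that of S⁴ (b₂ = 0).
The NEW OBJECT this route posits is an invariant that is not so forced: the Khovanov(–Rozansky)
skein lasagna module 𝒮₀(X; ∅)
[MorrisonWalkerWedrich2022], a diffeomorphism invariant of smooth 4-manifolds computable from a
handle decomposition for
2-handlebodies [ManolescuNeithalath2022] and shown in 2024 to DISTINGUISH exotic pairs (knot traces)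
[RenWillis2024] — the first
Khovanov-type invariant to see exotic smooth structure. Interface/construction split (D-0014):
interface = "𝒮 : closed smooth
oriented 4-manifold ↦ bigraded module, invariant under diffeomorphism, with 𝒮(S⁴) = ground ring in
bidegree (0,0)"; construction
item = the definition request `skeinLasagnaModule` (Literature has Khovanov homology of Gauss
diagrams, KhComplex.lean, to build on).
Imports: categorification / higher representation theory. Catalogue: this is the "lift to a richer
(categorified/TQFT) invariant"
entry; certified computation enters at crux 3 (lasagna modules of Gluck twists from Kirby diagrams
are finite computations in each
bidegree once 1- /3-handle formulas are available).

## Ranked cruxes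
2. (informal; needs_definition skeinLasagnaModule) ∃ 2-knot K: 𝒮₀(Σ_K; ∅) ≇ 𝒮₀(S⁴; ∅) as bigraded
modules. Decisive; implies X via
   the invariance fact.
3. (formal; the positive side, = ¬X) `Literature.Topology.FourManifolds.GluckTwistConjecture.{0}` —
SPC4 ⇒ it [Gluck1962]; provers on the positive side attack
   sub-families (ribbon 2-knots, twist-roll spun knots); a full proof closes this route.
4. (formal; positive side, sibling family)
`Literature.Topology.FourManifolds.CappellShanesonSpheresStandard` — open beyond the standard family
   [CappellShaneson1976, Akbulut2010, Gompf2010]; grounder: check whether it is now a Literature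
fact in full generality.
5. (cite fact) diffeomorphism invariance and S⁴-value of the lasagna module
[MorrisonWalkerWedrich2022, Thm 1.1/§5];
   3- /4-handle behaviour (surjection/isomorphism) [ManolescuNeithalath2022; Manolescu–Walker–Wedrich
2023].

## Kill criteria
- crux 3 proved (all Gluck twists standard) ⇒ X refuted ⇒ close (pivot target: Cappell–Shaneson /
other families needs a new route).
- A theorem "𝒮₀(Σ; ∅) ≅ 𝒮₀(S⁴; ∅) for every homotopy 4-sphere Σ" (e.g. from a 3-handle surjectivity
+ H₂ = 0 argument) ⇒ crux 2
  dead ⇒ close unless another unforced invariant (families Bauer–Furuta, Pin(2)-equivariant) is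
named in a dated pivot note.

## Deliberately NOT decomposed yet
- Which K (Gompf's infinite-order-cork relatives, non-ribbon 2-knots with few critical points) —
search detail.
- Lee/𝔰𝔩_N deformations and the lasagna s-invariant of [RenWillis2024] as the practical detector —
after the definition lands.

History (route lifecycle, newest last):
- 2026-08-15T12:55:58Z · CLOSED closed — route-repair guardrail: kill criterion 2 fired in print for the posited detector (RenWillis2024 Prop 6.17; Ren-Sullivan-Wedrich-Willis-Zhang 2025 Thm 7.1: gl2 lasagna modules over Q are Gluck-twist in (planner-SmoothPoincare4-route-SmoothPoincare4-GluckLasagna-0)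

sub-problem: SmoothPoincare4 · status: closed(closed) · opened planner-SmoothPoincare4-Survey-0 2026-08-13T06:11:42Z · rev 0 · ledger route-SmoothPoincare4-GluckLasagna
GENERATED by the gate from the ledger (D-0016/17). Provers cite these decls: `theorem foo : Summit.SmoothPoincare4.SmoothPoincare4.Theses.GluckLasagna.<Decl> := …` in Summits/SmoothPoincare4/SmoothPoincare4/Theorems/<Name>.lean.
-/

namespace Summit.SmoothPoincare4.SmoothPoincare4.Theses.GluckLasagna

open scoped BigOperators Topology Manifold Classical MeasureTheory ProbabilityTheory Matrix InnerProductSpace ComplexConjugate ContinuousMap ContDiff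
open Filter Set Function TopologicalSpace MeasureTheory

attribute [summit_statement] _root_.SmoothPoincare4

open Literature.SPC4

/-- item stmt-SmoothPoincare4-0387 · crux · rank 0 · closed · moot by None · by planner
∃ 2-knot K and a Gluck twist X of S⁴ along K (`Literature.Topology.FourManifolds.IsGluckTwist (𝓡 4)
X K`, GluckTwist.lean) with no diffeomorphism X ≃ₘ S⁴; i.e. ¬
Literature.Topology.FourManifolds.GluckTwistConjecture.{0}. Sources: Gluck1962; Kirby1997 4.24;
RenWillis2024; MorrisonWalkerWedrich2022. opens: `open scoped Manifold ContDiff`, `open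
ContinuousMap`; imports: Summits.SmoothPoincare4.Statement +
Literature.Topology.FourManifolds.{HomotopySpheres,KirbyMoves,SliceRibbon,LeeRasmussen,Morse,ConnectedSum,Cobordism,GluckTwist,SurgeryGluck,CappellShaneson}
+ Literature.Geometry.Lorentzian.LeviCivita. [elaboration note 2026-08-13: depends on
Literature.Topology.FourManifolds.Knots whose .olean is missing at HEAD (Knots.lean has 3 proofs
broken by the M5 demotion of IsAmbientIsotopic.symm/trans/isSmoothlyIsotopic to Props); signature
elaborated against a locally patched overlay build — re-run `lean check` once Knots is rebuilt.] -/
@[route_item "route-SmoothPoincare4-GluckLasagna"]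
def GlasThesis : Prop :=
  ∃ (K : Literature.Topology.FourManifolds.TwoKnot) (X : Type) (_ : TopologicalSpace X) (_ : T2Space X) (_ : SecondCountableTopology X) (_ : ChartedSpace (EuclideanSpace ℝ (Fin 4)) X) (_ : IsManifold (𝓡 4) ∞ X), Literature.Topology.FourManifolds.IsGluckTwist (𝓡 4) X K ∧ IsEmpty (X ≃ₘ⟮𝓡 4, 𝓡 4⟯ Metric.sphere (0 : EuclideanSpace ℝ (Fin 5)) 1)

-- item stmt-SmoothPoincare4-0389 · crux · rank 2 · closed · moot by None · by planner — informal only, no Lean statement yet: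
--   INFORMAL (needs_definition: skeinLasagnaModule). ∃ K : Literature.Topology.FourManifolds.TwoKnot, ∃
--   X Gluck twist along K, the Khovanov (gl₂, N = 2) skein lasagna module 𝒮₀(X; ∅, 0) is not isomorphic,
--   as a bigraded ℤ- (or ℚ-)module, to 𝒮₀(S⁴; ∅, 0) (= ground ring in bidegree (0,0),
--   MorrisonWalkerWedrich2022 §5). With the invariance fact this gives the thesis. This is the posited
--   NEW OBJECT of the route: an invariant of closed smooth 4-manifolds not forced to be trivial on
--   homotopy spheres, recently shown to detect exotica (RenWillis2024). Sources:
--   MorrisonWalkerWedrich2022; ManolescuNeithalath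

/-- item stmt-SmoothPoincare4-0390 · support · rank 3 · closed · moot by None · by planner
Literature def (SurgeryGluck.lean): every Gluck twist of S⁴ is diffeomorphic to S⁴. SPC4 ⇒ it;
proving it CLOSES route GluckLasagna. Known sub-families: twist-spun knots (Gordon1976),
0- /ribbon-type and many handlebody families (AkbulutKirby1985, GompfStipsicz1999 §6.2,
NashStipsicz2012), unknot (Literature
`nonempty_diffeomorph_sphere_four_of_isGluckTwist_of_isUnknot`). Sources: Gluck1962; Gordon1976;
Kirby1997 4.24. [elaboration note 2026-08-13: depends on Literature.Topology.FourManifolds.Knots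
whose .olean is missing at HEAD (Knots.lean has 3 proofs broken by the M5 demotion of
IsAmbientIsotopic.symm/trans/isSmoothlyIsotopic to Props); signature elaborated against a locally
patched overlay build — re-run `lean check` once Knots is rebuilt.] -/
@[route_item "route-SmoothPoincare4-GluckLasagna"]
def GlasGluckTwistConjecture : Prop :=
  Literature.Topology.FourManifolds.GluckTwistConjecture.{0}

/-- item stmt-SmoothPoincare4-0391 · support · rank 4 · closed · moot by None · by planner
Literature def (CappellShaneson.lean). Known for the standard family A_m and both framings
(Akbulut2010, Gompf2010; Literature
`nonempty_diffeomorph_sphere_four_of_isCappellShanesonSphereOf`); general A ∈ SL(3,ℤ) with det(A −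
1) = ±1 open per the Literature docstring — grounder: confirm current status (Gompf 2010 'More
Cappell–Shaneson spheres are standard'; later work of Kim–Yamada / Earle?). Sources:
CappellShaneson1976; Akbulut2010; Gompf2010; AkbulutKirby1985. [elaboration note 2026-08-13: depends
on Literature.Topology.FourManifolds.Knots whose .olean is missing at HEAD (Knots.lean has 3 proofs
broken by the M5 demotion of IsAmbientIsotopic.symm/trans/isSmoothlyIsotopic to Props); signature
elaborated against a locally patched overlay build — re-run `lean check` once Knots is rebuilt.] -/
@[route_item "route-SmoothPoincare4-GluckLasagna"]
def GlasCappellShanesonStandard : Prop :=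
  Literature.Topology.FourManifolds.CappellShanesonSpheresStandard

/-- item stmt-SmoothPoincare4-0388 · assembly · rank 1 · closed · moot by None · by planner
A Gluck twist is T2, second countable, compact, simply connected and homeomorphic (hence ≃ₕ) to S⁴
(Literature GluckTwist.lean: `simplyConnectedSpace_of_isGluckTwist`, `IsGluckTwist.compactSpace`,
`nonempty_homeomorph_sphere_of_isGluckTwist`); feed the homotopy equivalence to SmoothPoincare4 at M
:= X to contradict IsEmpty. Sources: Gluck1962 §17; Freedman1982 Thm 1.6. [elaboration note
2026-08-13: depends on Literature.Topology.FourManifolds.Knots whose .olean is missing at HEAD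
(Knots.lean has 3 proofs broken by the M5 demotion of
IsAmbientIsotopic.symm/trans/isSmoothlyIsotopic to Props); signature elaborated against a locally
patched overlay build — re-run `lean check` once Knots is rebuilt.] -/
@[route_item "route-SmoothPoincare4-GluckLasagna"]
def Assembly : Prop :=
  (∃ (K : Literature.Topology.FourManifolds.TwoKnot) (X : Type) (_ : TopologicalSpace X) (_ : T2Space X) (_ : SecondCountableTopology X) (_ : ChartedSpace (EuclideanSpace ℝ (Fin 4)) X) (_ : IsManifold (𝓡 4) ∞ X), Literature.Topology.FourManifolds.IsGluckTwist (𝓡 4) X K ∧ IsEmpty (X ≃ₘ⟮𝓡 4, 𝓡 4⟯ Metric.sphere (0 : EuclideanSpace ℝ (Fin 5)) 1)) → ¬ SmoothPoincare4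

/-- item stmt-SmoothPoincare4-0450 · assembly · rank 1 · closed · moot by None · by planner
SUPERSEDES stmt-SmoothPoincare4-0388 (grounder-ground-B-0 06:41Z: the three GluckTwist.lean lemmas
0388 relies on are `theorem … := by sorry` at HEAD, i.e. facts-to-be under D-0014, so they must be
premises). Only ONE is needed: SmoothPoincareConjectureFour binds ∀ (M : Type) [TopologicalSpace]
[T2Space] [SecondCountableTopology] [ChartedSpace] [IsManifold], M ≃ₕ S⁴ → Nonempty (M ≃ₘ S⁴) — no
CompactSpace, no SimplyConnectedSpace binder. Statement: (hH : ∀ K X …, IsGluckTwist (𝓡 4) X K →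
Nonempty (X ≃ₜ S⁴)) [fact item filed this session, Gluck1962 §17 + Freedman1982 Thm 1.6] → (∃ K X …,
IsGluckTwist (𝓡 4) X K ∧ IsEmpty (X ≃ₘ S⁴)) [= thesis 0387] → ¬ SmoothPoincare4. Proof recipe (≈8
lines): rintro hH ⟨K, X, _, _, _, _, _, hG, hE⟩ hS; obtain ⟨t⟩ := hH K X hG; exact hE.false
(Classical.choice (hS X t.toHomotopyEquiv)) — `Homeomorph.toHomotopyEquiv` is Mathlib; unfold
SmoothPoincare4 / Literature.SPC4.SmoothPoincareConjectureFour /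
HomotopyEquiv.NonemptyDiffeomorphSphere as in the 0441 proof. Believed PROVABLE NOW. All
knot-dependent signatures of this route (0387, 0388, 0390, 0391) re-elaborated at HEAD with plain
`lean check` on 2026-08-13 session 4 (folder/Sk/SketchGenB_head.lean rc -/
@[route_item "route-SmoothPoincare4-GluckLasagna"]
def Assembly2 : Prop :=
  (∀ (K : Literature.Topology.FourManifolds.TwoKnot) (X : Type) [TopologicalSpace X] [T2Space X] [SecondCountableTopology X] [ChartedSpace (EuclideanSpace ℝ (Fin 4)) X] [IsManifold (𝓡 4) ∞ X], Literature.Topology.FourManifolds.IsGluckTwist (𝓡 4) X K → Nonempty (X ≃ₜ Metric.sphere (0 : EuclideanSpace ℝ (Fin 5)) 1)) → (∃ (K : Literature.Topology.FourManifolds.TwoKnot) (X : Type) (_ : TopologicalSpace X) (_ : T2Space X) (_ : SecondCountableTopology X) (_ : ChartedSpace (EuclideanSpace ℝ (Fin 4)) X) (_ : IsManifold (𝓡 4) ∞ X), Literature.Topology.FourManifolds.IsGluckTwist (𝓡 4) X K ∧ IsEmpty (X ≃ₘ⟮𝓡 4, 𝓡 4⟯ Metric.sphere (0 : EuclideanSpace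 ℝ (Fin 5)) 1)) → ¬ SmoothPoincare4

end Summit.SmoothPoincare4.SmoothPoincare4.Theses.GluckLasagna
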